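import Literature.Topology.FourManifolds.RegularSlabCobordism
import Literature.Topology.FourManifolds.RegularLevelSplitting
import HarnessLib

/-!
# A compact slab `f⁻¹[a, b]` between two regular values is a cobordism between its levels

Topic `Literature/Topology/FourManifolds`; companion of `RegularSlabOfProper.lean` (Milnor,
*Morse theory* (1963), Thm. 3.1 — slabs WITHOUT critical points) and `RegularSlabCobordism.lean`
(slabs of a Morse function on a cobordism), written for the construction of the cobordism `X`
of Akbulut–Ruberman (2016), Lemma 2.3, as a slab of a height function on an open glued
4-manifold (fact seat of `Literature.Barriers.SmoothPoincare4.akbulutRuberman2016_symmetryKillingCobordism`),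
where the height has critical points inside the slab. The statement is Milnor, *Lectures on the
h-cobordism theorem* (1965), Lemma 2.9 with Def. 1.1, in the setting of *Morse theory* §3:

> if `f : M → ℝ` is smooth on the boundaryless manifold `M`, `a < b` are REGULAR VALUES of
> `f` and the slab `f⁻¹[a, b]` is compact, then `(f⁻¹[a, b]; f⁻¹(a), f⁻¹(b))` is a smooth
> manifold triad, i.e. a cobordism from `f⁻¹(a)` to `f⁻¹(b)` — whatever the critical points of
> `f` with values in `(a, b)`.

Proof as in the tree: the slab is the regular sublevel set `{F ≤ 0}`, `F = (f - a)(f - b)`, and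
`F` is regular along `{F = 0} = f⁻¹(a) ⊔ f⁻¹(b)` because `dF = (2f - a - b) df` there and `a`,
`b` are regular values (`RegularSublevel`, `RegularLevelSplitting.lean`); its boundary splits
into the two open-and-closed levels, embedded by the boundary inclusion
(`BoundaryManifold.isSmoothEmbedding_opens_val`).

* `IsCompactRegularSlab k f a b` — the hypothesis (smooth `f`, `a < b`, compact slab, no
  critical point ON the two levels);
* `CompactSlab h` — the slab as a compact `C^∞` manifold with boundary, `incl`, `mk`,
  `mem_boundary_iff` (`f = a ∨ f = b`), `isInteriorPoint_iff` (`a < f < b`);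
* `CompactSlab.botEnd`, `topEnd` — the levels as open(-and-closed) pieces of `∂`, compact;
* `CompactSlab.cobordism h : Cobordism k (botEnd h) (topEnd h)`.

Everything here is proved; no named facts are introduced.

## References

* J. Milnor, *Lectures on the h-cobordism theorem* (1965), Def. 1.1, Lemma 2.9.
  [MilnorHCobordism1965]
* J. Milnor, *Morse theory*, Ann. of Math. Studies 51 (1963), §3, Thm. 3.1. [Milnor1963]
-/

open scoped Manifold ContDiff Topology
open Set Function

noncomputable section

universe u

namespace Literature.Topology.FourManifolds

/-- Local notation: `𝔼 n` is the model Euclidean space `EuclideanSpace ℝ (Fin n)`. -/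
local notation "𝔼 " n:arg => EuclideanSpace ℝ (Fin n)

variable {k : ℕ} {M : Type u} [TopologicalSpace M] [ChartedSpace (𝔼 (k + 1)) M]
  [IsManifold (𝓡 (k + 1)) ∞ M]

/-! ### The hypothesis: a compact slab between two regular values -/

/-- **A compact slab between regular values**: `f : M → ℝ` smooth on the boundaryless manifold
`M`, `a < b`, the slab `f⁻¹[a, b]` compact, and no critical point of `f` on the levels `f = a`,
`f = b` (critical points in the open slab are allowed). [cite: MilnorHCobordism1965, Lemma 2.9] -/
structure IsCompactRegularSlab (k : ℕ) {M : Type u} [TopologicalSpace M]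
    [ChartedSpace (𝔼 (k + 1)) M] (f : M → ℝ) (a b : ℝ) : Prop where
  /-- `f` is smooth -/
  contMDiff : ContMDiff (𝓡 (k + 1)) 𝓘(ℝ, ℝ) ∞ f
  /-- `a < b` -/
  lt : a < b
  /-- the slab is compact -/
  isCompact : IsCompact (f ⁻¹' Icc a b)
  /-- no critical point of `f` on the lower level -/
  not_isMCriticalPt_bot : ∀ z, f z = a → ¬ IsMCriticalPt (𝓡 (k + 1)) f z
  /-- no critical point of `f` on the upper level -/
  not_isMCriticalPt_top : ∀ z, f z = b → ¬ IsMCriticalPt (𝓡 (k + 1)) f z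

namespace IsCompactRegularSlab

variable {f : M → ℝ} {a b : ℝ} (h : IsCompactRegularSlab k f a b)
include h

omit [IsManifold (𝓡 (k + 1)) ∞ M] in
/-- `f` is differentiable. [folklore] -/
theorem mdifferentiableAt (z : M) : MDifferentiableAt (𝓡 (k + 1)) 𝓘(ℝ, ℝ) f z :=
  h.contMDiff.mdifferentiableAt (by simp)

/-- The function `F = (f - a)(f - b)` presenting the slab as `{F ≤ 0}` (Milnor 1965, Lemma 2.9).
[cite: MilnorHCobordism1965, Lemma 2.9] -/
def slabFun (_h : IsCompactRegularSlab k f a b) : M → ℝ := fun z => (f z - a) * (f z - b)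

omit [IsManifold (𝓡 (k + 1)) ∞ M] in
/-- Formula. [folklore] -/
@[simp] theorem slabFun_apply (z : M) : h.slabFun z = (f z - a) * (f z - b) := rfl

omit [IsManifold (𝓡 (k + 1)) ∞ M] in
/-- The slab is `{F ≤ 0}`. [cite: MilnorHCobordism1965, Lemma 2.9] -/
theorem preimage_Icc_eq : f ⁻¹' Icc a b = h.slabFun ⁻¹' Iic 0 := by
  ext z
  simp only [mem_preimage, mem_Icc, mem_Iic, slabFun_apply]
  constructor
  · rintro ⟨h1, h2⟩
    exact mul_nonpos_iff.2 (Or.inl ⟨sub_nonneg.2 h1, sub_nonpos.2 h2⟩)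
  · intro hz
    rcases mul_nonpos_iff.1 hz with ⟨h1, h2⟩ | ⟨h1, h2⟩
    · exact ⟨sub_nonneg.1 h1, sub_nonpos.1 h2⟩
    · have h1' := sub_nonpos.1 h1
      have h2' := sub_nonneg.1 h2
      exact absurd (h2'.trans h1') (not_le.2 h.lt)

omit [IsManifold (𝓡 (k + 1)) ∞ M] in
/-- `F ≤ 0 ↔ a ≤ f ≤ b`. [folklore] -/
theorem slabFun_nonpos_iff (z : M) : h.slabFun z ≤ 0 ↔ f z ∈ Icc a b := by
  have := Set.ext_iff.1 h.preimage_Icc_eq z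
  simp only [mem_preimage, mem_Iic] at this
  exact this.symm

omit [IsManifold (𝓡 (k + 1)) ∞ M] in
/-- `F < 0` exactly on the open slab. [folklore] -/
theorem slabFun_neg_iff (z : M) : h.slabFun z < 0 ↔ f z ∈ Ioo a b := by
  rw [slabFun_apply, mul_neg_iff]
  constructor
  · rintro (⟨h1, h2⟩ | ⟨h1, h2⟩)
    · exact ⟨sub_pos.1 h1, sub_neg.1 h2⟩
    · exact absurd ((sub_pos.1 h2).trans (sub_neg.1 h1)) (lt_asymm h.lt)
  · rintro ⟨h1, h2⟩
    exact Or.inl ⟨sub_pos.2 h1, sub_neg.2 h2⟩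

omit [IsManifold (𝓡 (k + 1)) ∞ M] in
/-- `F = 0` exactly on the two levels. [folklore] -/
theorem slabFun_eq_zero_iff (z : M) : h.slabFun z = 0 ↔ f z = a ∨ f z = b := by
  rw [slabFun_apply, mul_eq_zero, sub_eq_zero, sub_eq_zero]

omit [IsManifold (𝓡 (k + 1)) ∞ M] in
/-- `F` is smooth. [folklore] -/
theorem contMDiff_slabFun : ContMDiff (𝓡 (k + 1)) 𝓘(ℝ, ℝ) ∞ h.slabFun :=
  ((contDiff_id.sub contDiff_const).mul (contDiff_id.sub contDiff_const)).comp_contMDiff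
    h.contMDiff

omit [IsManifold (𝓡 (k + 1)) ∞ M] in
/-- `dF = (2f - a - b) df`. [folklore] -/
theorem mfderiv_slabFun (z : M) :
    mfderiv (𝓡 (k + 1)) 𝓘(ℝ, ℝ) h.slabFun z =
      (2 * f z - a - b) • mfderiv (𝓡 (k + 1)) 𝓘(ℝ, ℝ) f z := by
  have h1 : HasDerivAt (fun t : ℝ => t - a) 1 (f z) := (hasDerivAt_id _).sub_const a
  have h2 : HasDerivAt (fun t : ℝ => t - b) 1 (f z) := (hasDerivAt_id _).sub_const b
  have hψ : HasDerivAt (fun t : ℝ => (t - a) * (t - b)) (1 * (f z - b) + (f z - a) * 1) (f z) :=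
    h1.mul h2
  have hg := (h.mdifferentiableAt z).hasMFDerivAt
  have hcomp : HasMFDerivAt (𝓡 (k + 1)) 𝓘(ℝ, ℝ) h.slabFun z
      ((ContinuousLinearMap.toSpanSingleton ℝ (1 * (f z - b) + (f z - a) * 1)).comp
        (mfderiv (𝓡 (k + 1)) 𝓘(ℝ, ℝ) f z)) :=
    (hψ.hasFDerivAt.hasMFDerivAt).comp z hg
  rw [hcomp.mfderiv]
  have hr : ContinuousLinearMap.toSpanSingleton ℝ (1 * (f z - b) + (f z - a) * 1) =
      (2 * f z - a - b) • ContinuousLinearMap.id ℝ ℝ := by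
    apply ContinuousLinearMap.ext_ring
    show (1 : ℝ) • (1 * (f z - b) + (f z - a) * 1) = (2 * f z - a - b) • (1 : ℝ)
    rw [smul_eq_mul, smul_eq_mul]
    ring
  rw [hr, ContinuousLinearMap.smul_comp, ContinuousLinearMap.id_comp]
  rfl

omit [IsManifold (𝓡 (k + 1)) ∞ M] in
/-- **`0` is a regular level of `F`** (Milnor 1965, Lemma 2.9: on `{F = 0} = {f = a} ⊔ {f = b}`,
`dF = ∓(b - a) df ≠ 0` because `a`, `b` are regular values). [cite: MilnorHCobordism1965, Lemma 2.9] -/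
theorem isRegularLevel_slabFun : IsRegularLevel (𝓡 (k + 1)) h.slabFun 0 := by
  refine isRegularLevel_of_not_isMCriticalPt h.contMDiff_slabFun fun z hz hcrit => ?_
  unfold IsMCriticalPt at hcrit
  rw [h.mfderiv_slabFun z] at hcrit
  rcases (h.slabFun_eq_zero_iff z).1 hz with hza | hzb
  · have hne : 2 * f z - a - b ≠ 0 := by
      rw [hza]; intro h0; exact h.lt.ne (by linarith)
    exact h.not_isMCriticalPt_bot z hza ((smul_eq_zero_iff_right hne).1 hcrit)
  · have hne : 2 * f z - a - b ≠ 0 := by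
      rw [hzb]; intro h0; exact h.lt.ne (by linarith)
    exact h.not_isMCriticalPt_top z hzb ((smul_eq_zero_iff_right hne).1 hcrit)

end IsCompactRegularSlab

/-! ### The slab as a compact manifold with boundary `{f = a} ⊔ {f = b}` -/

/-- **The slab `f⁻¹[a, b]` as a compact `C^∞` manifold with boundary**: the regular sublevel set
`{F ≤ 0}` (Milnor 1965, Lemma 2.9; tree `RegularSublevel`). [cite: MilnorHCobordism1965, Lemma 2.9] -/
abbrev CompactSlab {f : M → ℝ} {a b : ℝ} (h : IsCompactRegularSlab k f a b) : Type u :=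
  RegularSublevel h.isRegularLevel_slabFun

namespace CompactSlab

variable {f : M → ℝ} {a b : ℝ} (h : IsCompactRegularSlab k f a b)

/-- The inclusion of the slab into `M`. [folklore] -/
abbrev incl : CompactSlab h → M := RegularSublevel.incl h.isRegularLevel_slabFun

omit [IsManifold (𝓡 (k + 1)) ∞ M] in
/-- Points of the slab have `a ≤ f ≤ b`. [folklore] -/
theorem apply_incl_mem (p : CompactSlab h) : f (incl h p) ∈ Icc a b :=
  (h.slabFun_nonpos_iff _).1 p.2

/-- The point of the slab given by `z` with `a ≤ f z ≤ b`. [folklore] -/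
abbrev mk (z : M) (hz : f z ∈ Icc a b) : CompactSlab h :=
  RegularSublevel.mk h.isRegularLevel_slabFun z ((h.slabFun_nonpos_iff z).2 hz)

omit [IsManifold (𝓡 (k + 1)) ∞ M] in
/-- `incl (mk z) = z` (definitional). [folklore] -/
@[simp] theorem incl_mk (z : M) (hz : f z ∈ Icc a b) : incl h (mk h z hz) = z := rfl

omit [IsManifold (𝓡 (k + 1)) ∞ M] in
/-- `range incl = f⁻¹[a, b]`. [folklore] -/
theorem range_incl : range (incl h) = f ⁻¹' Icc a b := by
  ext z
  constructor
  · rintro ⟨p, rfl⟩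
    exact apply_incl_mem h p
  · intro hz
    exact ⟨mk h z hz, rfl⟩

/-- The slab is compact (as a space). [folklore] -/
instance instCompactSpace : CompactSpace (CompactSlab h) := by
  have hK : IsCompact (h.slabFun ⁻¹' Iic 0) := h.preimage_Icc_eq ▸ h.isCompact
  exact isCompact_iff_compactSpace.1 hK

/-- **Boundary points of the slab are the points of the two levels** `f = a`, `f = b`.
[cite: MilnorHCobordism1965, Lemma 2.9] -/
theorem mem_boundary_iff (p : CompactSlab h) :
    p ∈ (𝓡∂ (k + 1)).boundary (CompactSlab h) ↔ f (incl h p) = a ∨ f (incl h p) = b := by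
  rw [RegularSublevel.mem_boundary_iff, ← h.slabFun_eq_zero_iff]

/-- Interior points of the slab are the points of the open slab `a < f < b`. [folklore] -/
theorem isInteriorPoint_iff (p : CompactSlab h) :
    (𝓡∂ (k + 1)).IsInteriorPoint p ↔ f (incl h p) ∈ Ioo a b := by
  rw [RegularSublevel.isInteriorPoint_iff, ← h.slabFun_neg_iff]

/-- The boundary of the slab is compact. [folklore] -/
instance instCompactSpaceBoundary : CompactSpace ((𝓡∂ (k + 1)).boundary (CompactSlab h)) :=
  isCompact_iff_compactSpace.1
    ((𝓡∂ (k + 1)).isClosed_boundary (M := CompactSlab h) (n := ∞) (by simp)).isCompact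

/-- `f` read on the boundary is continuous. [folklore] -/
theorem continuous_apply_boundary :
    Continuous fun p : (𝓡∂ (k + 1)).boundary (CompactSlab h) => f (incl h p.1) :=
  h.contMDiff.continuous.comp ((RegularSublevel.continuous_incl _).comp continuous_subtype_val)

/-- **The lower end `f⁻¹(a)`** as an open piece of `∂S` (`f < (a+b)/2` there). [cite: MilnorHCobordism1965, Lemma 2.9 with Def. 1.1] -/
def botEnd : TopologicalSpace.Opens ((𝓡∂ (k + 1)).boundary (CompactSlab h)) :=
  ⟨{p | f (incl h p.1) < (a + b) / 2}, isOpen_lt (continuous_apply_boundary h) continuous_const⟩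

/-- **The upper end `f⁻¹(b)`** as an open piece of `∂S`. [cite: MilnorHCobordism1965, Lemma 2.9 with Def. 1.1] -/
def topEnd : TopologicalSpace.Opens ((𝓡∂ (k + 1)).boundary (CompactSlab h)) :=
  ⟨{p | (a + b) / 2 < f (incl h p.1)}, isOpen_lt continuous_const (continuous_apply_boundary h)⟩

/-- A boundary point lies in the lower end iff `f = a` there. [folklore] -/
theorem mem_botEnd_iff (p : (𝓡∂ (k + 1)).boundary (CompactSlab h)) :
    p ∈ botEnd h ↔ f (incl h p.1) = a := by
  have hp : f (incl h p.1) = a ∨ f (incl h p.1) = b := (mem_boundary_iff h p.1).1 p.2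
  have hlt := h.lt
  show f (incl h p.1) < (a + b) / 2 ↔ _
  rcases hp with hp | hp <;> rw [hp]
  · exact ⟨fun _ => rfl, fun _ => by linarith⟩
  · exact ⟨fun h' => by linarith, fun h' => by linarith⟩

/-- A boundary point lies in the upper end iff `f = b` there. [folklore] -/
theorem mem_topEnd_iff (p : (𝓡∂ (k + 1)).boundary (CompactSlab h)) :
    p ∈ topEnd h ↔ f (incl h p.1) = b := by
  have hp : f (incl h p.1) = a ∨ f (incl h p.1) = b := (mem_boundary_iff h p.1).1 p.2
  have hlt := h.lt
  show (a + b) / 2 < f (incl h p.1) ↔ _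
  rcases hp with hp | hp <;> rw [hp]
  · exact ⟨fun h' => by linarith, fun h' => by linarith⟩
  · exact ⟨fun _ => rfl, fun _ => by linarith⟩

/-- On the lower end `f = a`. [folklore] -/
theorem apply_botEnd (p : botEnd h) : f (incl h p.1.1) = a := (mem_botEnd_iff h p.1).1 p.2

/-- On the upper end `f = b`. [folklore] -/
theorem apply_topEnd (p : topEnd h) : f (incl h p.1.1) = b := (mem_topEnd_iff h p.1).1 p.2

/-- The lower end is closed in `∂S`. [folklore] -/
theorem isClosed_botEnd : IsClosed (botEnd h : Set ((𝓡∂ (k + 1)).boundary (CompactSlab h))) := by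
  have : (botEnd h : Set ((𝓡∂ (k + 1)).boundary (CompactSlab h))) =
      {p | f (incl h p.1) ≤ a} := by
    ext p
    rw [SetLike.mem_coe, mem_botEnd_iff]
    exact ⟨fun h' => h'.le, fun h' => le_antisymm h' (apply_incl_mem h p.1).1⟩
  rw [this]
  exact isClosed_le (continuous_apply_boundary h) continuous_const

/-- The upper end is closed in `∂S`. [folklore] -/
theorem isClosed_topEnd : IsClosed (topEnd h : Set ((𝓡∂ (k + 1)).boundary (CompactSlab h))) := by
  have : (topEnd h : Set ((𝓡∂ (k + 1)).boundary (CompactSlab h))) =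
      {p | b ≤ f (incl h p.1)} := by
    ext p
    rw [SetLike.mem_coe, mem_topEnd_iff]
    exact ⟨fun h' => h'.ge, fun h' => le_antisymm (apply_incl_mem h p.1).2 h'⟩
  rw [this]
  exact isClosed_le continuous_const (continuous_apply_boundary h)

/-- The lower end is compact. [folklore] -/
instance instCompactSpaceBotEnd : CompactSpace (botEnd h) :=
  isCompact_iff_compactSpace.1 (isClosed_botEnd h).isCompact

/-- The upper end is compact. [folklore] -/
instance instCompactSpaceTopEnd : CompactSpace (topEnd h) :=
  isCompact_iff_compactSpace.1 (isClosed_topEnd h).isCompact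

/-- **The point of the lower end given by `z` with `f z = a`.** [folklore] -/
def mkBot (z : M) (hz : f z = a) : botEnd h :=
  ⟨⟨mk h z ⟨hz.symm.le, hz.le.trans h.lt.le⟩, (mem_boundary_iff h _).2 (Or.inl hz)⟩,
    (mem_botEnd_iff h _).2 hz⟩

/-- **The point of the upper end given by `z` with `f z = b`.** [folklore] -/
def mkTop (z : M) (hz : f z = b) : topEnd h :=
  ⟨⟨mk h z ⟨h.lt.le.trans hz.symm.le, hz.le⟩, (mem_boundary_iff h _).2 (Or.inr hz)⟩,
    (mem_topEnd_iff h _).2 hz⟩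

/-- `mkBot` read in `M` (definitional). [folklore] -/
@[simp] theorem incl_mkBot (z : M) (hz : f z = a) : incl h (mkBot h z hz).1.1 = z := rfl

/-- `mkTop` read in `M` (definitional). [folklore] -/
@[simp] theorem incl_mkTop (z : M) (hz : f z = b) : incl h (mkTop h z hz).1.1 = z := rfl

/-- Every point of the lower end is an `mkBot`. [folklore] -/
theorem mkBot_surjective : ∀ p : botEnd h, ∃ z hz, mkBot h z hz = p := fun p =>
  ⟨incl h p.1.1, apply_botEnd h p, Subtype.ext (Subtype.ext (Subtype.ext rfl))⟩

/-- Every point of the upper end is an `mkTop`. [folklore] -/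
theorem mkTop_surjective : ∀ p : topEnd h, ∃ z hz, mkTop h z hz = p := fun p =>
  ⟨incl h p.1.1, apply_topEnd h p, Subtype.ext (Subtype.ext (Subtype.ext rfl))⟩

variable [T2Space M] [SecondCountableTopology M]

/-- **Milnor 1965, Lemma 2.9 with Def. 1.1: the compact slab `f⁻¹[a, b]` between two regular
values is a cobordism from `f⁻¹(a)` to `f⁻¹(b)`.** [cite: MilnorHCobordism1965, Lemma 2.9 with Def. 1.1] [cite: Milnor1963, §3 Thm. 3.1] -/
def cobordism : Cobordism k (botEnd h) (topEnd h) where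
  W := CompactSlab h
  inl p := (p.1 : CompactSlab h)
  inr p := (p.1 : CompactSlab h)
  isSmoothEmbedding_inl := BoundaryManifold.isSmoothEmbedding_opens_val (botEnd h)
  isSmoothEmbedding_inr := BoundaryManifold.isSmoothEmbedding_opens_val (topEnd h)
  disjoint_range := by
    refine disjoint_left.2 ?_
    rintro z ⟨p, rfl⟩ ⟨q, hq⟩
    have ha := apply_botEnd h p
    have hb := apply_topEnd h q
    have hpq : (q.1 : CompactSlab h) = p.1 := hq
    rw [hpq] at hb
    exact h.lt.ne (ha.symm.trans hb)
  range_inl_union_range_inr := by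
    ext z
    simp only [mem_union, mem_range]
    constructor
    · rintro (⟨p, rfl⟩ | ⟨p, rfl⟩)
      · exact p.1.2
      · exact p.1.2
    · intro hz
      rcases (mem_boundary_iff h z).1 hz with hza | hzb
      · exact Or.inl ⟨⟨⟨z, hz⟩, (mem_botEnd_iff h ⟨z, hz⟩).2 hza⟩, rfl⟩
      · exact Or.inr ⟨⟨⟨z, hz⟩, (mem_topEnd_iff h ⟨z, hz⟩).2 hzb⟩, rfl⟩

/-- The total space of the slab cobordism is the slab (definitional). [folklore] -/
@[simp] theorem cobordism_W : (cobordism h).W = CompactSlab h := rfl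

/-- The incoming end is the inclusion of the lower level (definitional). [folklore] -/
@[simp] theorem cobordism_inl (p : botEnd h) : (cobordism h).inl p = (p.1 : CompactSlab h) := rfl

/-- The outgoing end is the inclusion of the upper level (definitional). [folklore] -/
@[simp] theorem cobordism_inr (p : topEnd h) : (cobordism h).inr p = (p.1 : CompactSlab h) := rfl

/-- The incoming end read in `M`: `incl (inl (mkBot z)) = z`. [folklore] -/
theorem incl_cobordism_inl_mkBot (z : M) (hz : f z = a) :
    incl h ((cobordism h).inl (mkBot h z hz)) = z := rfl

/-- The outgoing end read in `M`: `incl (inr (mkTop z)) = z`. [folklore] -/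
theorem incl_cobordism_inr_mkTop (z : M) (hz : f z = b) :
    incl h ((cobordism h).inr (mkTop h z hz)) = z := rfl

end CompactSlab

end Literature.Topology.FourManifolds

end
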